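import Summits.QuantumFields.Balaban3D.Proofs.FibreFormula
import HarnessLib

/-!
# `AlphaInputsT3ACWeightedFibreFormula` — the renormalization transform as a WEIGHTED fibre integral: for an averaging `Ū` whose fibres are
# parametrised by `Φ : (V, r) ↦ U` pushing a DENSITY `J·(dV ⊗ κ)` to `dU` (`Φ_*(J·(dV ⊗ κ)) = dU`, `Ū(Φ(V,r)) = V`), the Radon–Nikodym transport of every
# integrable density is `(Tρ)(V) = ∫ J(V,r)·ρ(Φ(V,r)) dκ(r)` dV-a.e. — the brick (B2-F1) of `pub/ym-inputs/I10-B2-FIBRE-LOCATE-p08.md` (cell ym3-torus,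
# desk pub/ym-inputs INPUT-LIST v7 §3 I-10; seat ym-inputs-p08 g2; helper `--supports stmt-QuantumFields-20520`)

WHY.  The lane's `Balaban3D.Proofs.FibreFormula.rnTransport_ae_eq_fibreIntegral` asks a MEASURE-PRESERVING parametrisation (`IsFibreParam.map_eq :
Φ_*(dV ⊗ κ) = dU`), which forces exact Haar compatibility `Ū_*(dU) = dV` (`map_avg_of_fibreParam`) — available for the lane's axial average
(`AxialFibre.isFibreParam_axial`) and for nothing else in the tree; the T³ record pins Bałaban's block averaging `BlockAveraging.blockAvg ℰp`
(`AlphaInputsT3AC.avT3_of_le`), which is only absolutely continuous (`T3UnitLawDensityEML.haarAC_blockAvg`).  Print resolves the fibre of that average by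
the chart `U = exp(i(A − D̃(A)))·U₁(V)` with the JACOBIAN `det(I − (δ/δA)D̃(A))` and the Haar density `σ(A − D̃(A))/σ₀` ([Balaban1985UV3] (13)–(18) pp.259–260,
(20)–(21) p.261, (51) p.268) — a parametrisation WITH A DENSITY.  THIS FILE is the density-carrying twin of the lane's fibre formula, generic in the
averaging, the parameter space `(R, κ)`, the map `Φ` and the weight `J ≥ 0` (all hypotheses unbundled; no structure, no definition):
* `avgAC_of_weightedFibre` — such a `Ū` is measurable with `Ū_*(dU) ≪ dV` (the lane's `Carriers.AvgAC`, binder D-1a; the density is `V ↦ ∫J(V,·) dκ`,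
  cf. `rnTransport_one_ae_eq_weight`);
* `isRT_weightedFibreIntegral` — `V ↦ ∫ J(V,r)·ρ(Φ(V,r)) dκ(r)` IS a renormalization transform of `ρ` (`Setup.IsRT`, push-forward reading of [Balaban1985Averaging]
  (10) p.19): Fubini on `dV ⊗ κ`, `∫ g d(J·ν) = ∫ J·g dν`, the change of variables `Φ`;
* `integrable_weightedFibreIntegral`, ★`rnTransport_ae_eq_weightedFibreIntegral` (`T ρ = ∫ J·ρ∘Φ dκ` a.e., by the uniqueness `RTAlgebra.IsRT.ae_eq`),
  `rnTransport_le_mul_of_weightedFibreIntegral` (the inequality shape of the (β) residuals), and `rnTransport_one_ae_eq_weight` — `T[1](V) = ∫ J(V,r) dκ(r)`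
  a.e.: the transported trivial mass is the total weight of the fibre, NOT `1` (the lane's finding F-α1-1 ∕ the `min 1` pin of `MassesPAC`, made explicit).
* the LOCAL form (`isRT_weightedFibreIntegral_local`, `integrable_weightedFibreIntegral_local`, ★`rnTransport_ae_eq_weightedFibreIntegral_local`): a chart
  of PART of the fibres — `Φ` on a measurable parameter set `S` pushing `J·(dV ⊗ κ)↾S` to `dU↾O` — gives `(Tρ)(V) = ∫ 𝟙_S·J·ρ∘Φ dκ` a.e. for densities
  supported in `O`, given `Carriers.AvgAC Ū` (print's (17) is solvable for small `A` only; the cut-off `χ` of (13)∕(49) keeps the integrand there).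
With `J ≡ 1`, `S = univ` these are the lane's statements.  The instance for `blockAvg ℰp` ((B2-F2): `Φ`, `J` from `B10Eq17LocalTorus` ∕
`B10Eq18ChangeOfVariables` ∕ `B10Eq18SigmaSU2Haar`) is NOT in this file.

HONEST SCOPE.  [folklore] measure theory (Fubini, `withDensity`, push-forward); nothing of [Balaban1985UV3] ∕ [Balaban1985Averaging] is asserted; count-neutral;
no summit ∕ sub-problem statement proved (rung R3 bookkeeping; not T⁴, not Clay; the Yang–Mills mass gap is NOT proved).  Def-free; L-floor: none.
References: T. Bałaban, CMP 102 (1985) 255–275 [Balaban1985UV3] ((10) p.258, (13)–(18) pp.259–260, (49)–(51) p.268); CMP 98 (1985) 17–51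
[Balaban1985Averaging] ((10) p.19).
-/

set_option autoImplicit false

noncomputable section

namespace Summit.QuantumFields.YangMills.Theorems.WeightedFibreFormula

open MeasureTheory
open scoped NNReal ENNReal
open Literature.MathematicalPhysics.QuantumFieldTheory.Balaban1983to89
open Literature.MathematicalPhysics.QuantumFieldTheory.Balaban1983to89.AveragingRT (rnTransport)
open Summit.QuantumFields.Balaban3D.Carriers (AvgAC isRT_rnTransport_of_ac integrable_rnTransport)
open Summit.QuantumFields.Balaban3D.Proofs.RTAlgebra

variable {P : Params} {j : ℕ} {G : Type*} [GaugeGroup G] [MeasurableSpace G] [HaarData G]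
  {R : Type*} [MeasurableSpace R] {κ : Measure R} [IsProbabilityMeasure κ]
  {avg : GaugeField P j G → GaugeField P (j + 1) G}
  {Φ : GaugeField P (j + 1) G × R → GaugeField P j G} {J : GaugeField P (j + 1) G × R → ℝ≥0}

/-- **`Ū_*(dU) ≪ dV` for an averaging with a weighted fibre parametrisation**: `Ū_*(dU) = Ū_*Φ_*(J·(dV⊗κ)) = fst_*(J·(dV⊗κ)) ≪ fst_*(dV⊗κ) = dV`.
The lane's binder `Carriers.AvgAC`. [cite: Balaban1985Averaging, (10) p.19] -/
theorem avgAC_of_weightedFibre (havg : Measurable avg) (hΦ : Measurable Φ)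
    (hmap : (((fieldMeasure P (j + 1) G).prod κ).withDensity (fun z => (J z : ℝ≥0∞))).map Φ = fieldMeasure P j G)
    (hfib : ∀ V r, avg (Φ (V, r)) = V) : AvgAC avg := by
  refine ⟨havg, ?_⟩
  have hcomp : avg ∘ Φ = Prod.fst := funext fun ⟨V, r⟩ => hfib V r
  rw [← hmap, Measure.map_map havg hΦ, hcomp]
  have hac : (((fieldMeasure P (j + 1) G).prod κ).withDensity (fun z => (J z : ℝ≥0∞))) ≪ (fieldMeasure P (j + 1) G).prod κ :=
    withDensity_absolutelyContinuous _ _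
  have h := hac.map measurable_fst
  rwa [Measure.map_fst_prod, measure_univ, one_smul] at h

/-- The weighted fibre integral of an integrable density is integrable on the coarse lattice (Fubini + the change of variables). [folklore] -/
theorem integrable_weightedFibreIntegral (hΦ : Measurable Φ) (hJ : Measurable J)
    (hmap : (((fieldMeasure P (j + 1) G).prod κ).withDensity (fun z => (J z : ℝ≥0∞))).map Φ = fieldMeasure P j G)
    (ρ : Density P j G) (hρ : Integrable ρ (fieldMeasure P j G)) :
    Integrable (fun V => ∫ r, (J (V, r) : ℝ) * ρ (Φ (V, r)) ∂κ) (fieldMeasure P (j + 1) G) := by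
  have hmp : MeasurePreserving Φ (((fieldMeasure P (j + 1) G).prod κ).withDensity (fun z => (J z : ℝ≥0∞))) (fieldMeasure P j G) :=
    ⟨hΦ, hmap⟩
  have hcomp : Integrable (ρ ∘ Φ) (((fieldMeasure P (j + 1) G).prod κ).withDensity (fun z => (J z : ℝ≥0∞))) :=
    (hmp.integrable_comp hρ.aestronglyMeasurable).mpr hρ
  have hsmul : Integrable (fun z => J z • (ρ ∘ Φ) z) ((fieldMeasure P (j + 1) G).prod κ) :=
    (integrable_withDensity_iff_integrable_smul hJ).mp hcomp
  have h := hsmul.integral_prod_left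
  refine h.congr (Filter.Eventually.of_forall fun V => ?_)
  refine integral_congr_ae (Filter.Eventually.of_forall fun r => ?_)
  simp only [Function.comp, NNReal.smul_def, smul_eq_mul]

/-- **THE WEIGHTED FIBRE INTEGRAL IS A RENORMALIZATION TRANSFORM** (push-forward reading `Setup.IsRT` of [Balaban1985Averaging] (10) p.19
«(Tρ)(V) = ∫dU δ(ŪV^{−1}) ρ(U)»): `∫dV [∫J(V,r)ρ(Φ(V,r))dκ(r)] f(V) = ∫dU ρ(U) f(Ū)` for bounded measurable `f` — Fubini on `dV ⊗ κ`, `∫ g d(J·ν) = ∫ J·g dν`,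
then the change of variables `Φ`. [cite: Balaban1985Averaging, (10) p.19] -/
theorem isRT_weightedFibreIntegral (havg : Measurable avg) (hΦ : Measurable Φ) (hJ : Measurable J)
    (hmap : (((fieldMeasure P (j + 1) G).prod κ).withDensity (fun z => (J z : ℝ≥0∞))).map Φ = fieldMeasure P j G)
    (hfib : ∀ V r, avg (Φ (V, r)) = V) (ρ : Density P j G) (hρ : Integrable ρ (fieldMeasure P j G)) :
    IsRT avg ρ (fun V => ∫ r, (J (V, r) : ℝ) * ρ (Φ (V, r)) ∂κ) := by
  intro f hf hfC
  obtain ⟨C, hC⟩ := hfC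
  set μ : Measure (GaugeField P (j + 1) G × R) :=
    ((fieldMeasure P (j + 1) G).prod κ).withDensity (fun z => (J z : ℝ≥0∞)) with hμ
  have hmp : MeasurePreserving Φ μ (fieldMeasure P j G) := ⟨hΦ, hmap⟩
  have hint : Integrable (fun U => ρ U * f (avg U)) (fieldMeasure P j G) := integrable_mul_test_comp hρ havg hf hC
  have hpull : Integrable ((fun U => ρ U * f (avg U)) ∘ Φ) μ := (hmp.integrable_comp hint.aestronglyMeasurable).mpr hint
  have hpull' : Integrable (fun z : GaugeField P (j + 1) G × R => ρ (Φ z) * f z.1) μ := by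
    refine hpull.congr (Filter.Eventually.of_forall fun z => ?_)
    obtain ⟨V, r⟩ := z
    show ρ (Φ (V, r)) * f (avg (Φ (V, r))) = ρ (Φ (V, r)) * f V
    rw [hfib]
  have hsmul : Integrable (fun z : GaugeField P (j + 1) G × R => J z • (ρ (Φ z) * f z.1)) ((fieldMeasure P (j + 1) G).prod κ) :=
    (integrable_withDensity_iff_integrable_smul hJ).mp hpull'
  have hsmul' : Integrable (fun z : GaugeField P (j + 1) G × R => (J z : ℝ) * ρ (Φ z) * f z.1) ((fieldMeasure P (j + 1) G).prod κ) := by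
    refine hsmul.congr (Filter.Eventually.of_forall fun z => ?_)
    simp only [NNReal.smul_def, smul_eq_mul, mul_assoc]
  calc ∫ V, (∫ r, (J (V, r) : ℝ) * ρ (Φ (V, r)) ∂κ) * f V ∂(fieldMeasure P (j + 1) G)
      = ∫ V, ∫ r, (J (V, r) : ℝ) * ρ (Φ (V, r)) * f V ∂κ ∂(fieldMeasure P (j + 1) G) := by
        refine integral_congr_ae (Filter.Eventually.of_forall fun V => ?_)
        exact (integral_mul_const (f V) _).symm
    _ = ∫ z, (J z : ℝ) * ρ (Φ z) * f z.1 ∂((fieldMeasure P (j + 1) G).prod κ) := (integral_prod _ hsmul').symm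
    _ = ∫ z, J z • (ρ (Φ z) * f z.1) ∂((fieldMeasure P (j + 1) G).prod κ) := by
        refine integral_congr_ae (Filter.Eventually.of_forall fun z => ?_)
        simp only [NNReal.smul_def, smul_eq_mul, mul_assoc]
    _ = ∫ z, ρ (Φ z) * f z.1 ∂μ := (integral_withDensity_eq_integral_smul hJ _).symm
    _ = ∫ z, ((fun U => ρ U * f (avg U)) ∘ Φ) z ∂μ := by
        refine integral_congr_ae (Filter.Eventually.of_forall fun z => ?_)
        obtain ⟨V, r⟩ := z
        show ρ (Φ (V, r)) * f V = ρ (Φ (V, r)) * f (avg (Φ (V, r)))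
        rw [hfib]
    _ = ∫ U, ρ U * f (avg U) ∂(fieldMeasure P j G) := by
        rw [← hmap, integral_map hΦ.aemeasurable]
        · rfl
        · rw [hmap]; exact hint.aestronglyMeasurable

/-- **THE WEIGHTED FIBRE FORMULA** for the Radon–Nikodym transport (the lane's `T`): `(Tρ)(V) = ∫ J(V,r)·ρ(Φ(V,r)) dκ(r)` for dV-a.e. `V`, for every
integrable density `ρ` (both sides are transforms of `ρ`; uniqueness a.e., `RTAlgebra.IsRT.ae_eq`).  Print's (13)+(17)+(18) for the block averaging is the
instance `Φ(V,A) = exp(i(A − D̃(A)))·U₁(V)`, `J = det(I − (δ/δA)D̃(A))·Πσ(A − D̃(A))/σ₀·const`. [cite: Balaban1985UV3, (10) p.258 + (13)–(18) pp.259–260] -/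
theorem rnTransport_ae_eq_weightedFibreIntegral (havg : Measurable avg) (hΦ : Measurable Φ) (hJ : Measurable J)
    (hmap : (((fieldMeasure P (j + 1) G).prod κ).withDensity (fun z => (J z : ℝ≥0∞))).map Φ = fieldMeasure P j G)
    (hfib : ∀ V r, avg (Φ (V, r)) = V) (ρ : Density P j G) (hρ : Integrable ρ (fieldMeasure P j G)) :
    rnTransport avg ρ =ᵐ[fieldMeasure P (j + 1) G] fun V => ∫ r, (J (V, r) : ℝ) * ρ (Φ (V, r)) ∂κ :=
  IsRT.ae_eq (isRT_rnTransport_of_ac (avgAC_of_weightedFibre havg hΦ hmap hfib) ρ hρ)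
    (isRT_weightedFibreIntegral havg hΦ hJ hmap hfib ρ hρ) havg hρ (integrable_rnTransport avg ρ hρ)
    (integrable_weightedFibreIntegral hΦ hJ hmap ρ hρ)

/-- Consequence for INEQUALITIES (the shape of the (β) residuals): to bound `T ρ₁ ≤ T ρ₂ · B` dV-a.e. it suffices to compare the weighted fibre
integrals pointwise. [folklore] -/
theorem rnTransport_le_mul_of_weightedFibreIntegral (havg : Measurable avg) (hΦ : Measurable Φ) (hJ : Measurable J)
    (hmap : (((fieldMeasure P (j + 1) G).prod κ).withDensity (fun z => (J z : ℝ≥0∞))).map Φ = fieldMeasure P j G)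
    (hfib : ∀ V r, avg (Φ (V, r)) = V) {ρ₁ ρ₂ : Density P j G} (h₁ : Integrable ρ₁ (fieldMeasure P j G))
    (h₂ : Integrable ρ₂ (fieldMeasure P j G)) (B : Density P (j + 1) G)
    (hle : ∀ᵐ V ∂(fieldMeasure P (j + 1) G),
      ∫ r, (J (V, r) : ℝ) * ρ₁ (Φ (V, r)) ∂κ ≤ (∫ r, (J (V, r) : ℝ) * ρ₂ (Φ (V, r)) ∂κ) * B V) :
    rnTransport avg ρ₁ ≤ᵐ[fieldMeasure P (j + 1) G] fun V => rnTransport avg ρ₂ V * B V := by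
  filter_upwards [rnTransport_ae_eq_weightedFibreIntegral havg hΦ hJ hmap hfib ρ₁ h₁,
    rnTransport_ae_eq_weightedFibreIntegral havg hΦ hJ hmap hfib ρ₂ h₂, hle] with V e₁ e₂ hV
  rw [e₁, e₂]
  exact hV

/-- **THE TRANSPORTED TRIVIAL MASS IS THE TOTAL WEIGHT OF THE FIBRE**: `T[1](V) = ∫ J(V,r) dκ(r)` dV-a.e. — `1` exactly when `J·κ` has mass one on
(almost) every fibre (the measure-preserving case of `FibreFormula`); for a covariant non-linear average this is the Radon–Nikodym derivative
`d(Ū_*dU)/dV`, in general NOT `1` (the lane's finding F-α1-1 behind the pinned masses of `MassesPAC`). [cite: Balaban1985UV3, (47) p.267 + p.272 L32–33] -/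
theorem rnTransport_one_ae_eq_weight (havg : Measurable avg) (hΦ : Measurable Φ) (hJ : Measurable J)
    (hmap : (((fieldMeasure P (j + 1) G).prod κ).withDensity (fun z => (J z : ℝ≥0∞))).map Φ = fieldMeasure P j G)
    (hfib : ∀ V r, avg (Φ (V, r)) = V) :
    rnTransport avg (fun _ => (1 : ℝ)) =ᵐ[fieldMeasure P (j + 1) G] fun V => ∫ r, (J (V, r) : ℝ) ∂κ := by
  have h := rnTransport_ae_eq_weightedFibreIntegral havg hΦ hJ hmap hfib (fun _ => (1 : ℝ)) (integrable_const _)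
  refine h.trans (Filter.Eventually.of_forall fun V => ?_)
  simp only [mul_one]

/-! ## The local form: a chart of PART of the fibres (print's (17) is solvable only on the small-field region) -/

/-- **THE WEIGHTED FIBRE FORMULA, LOCAL FORM.**  If the chart `Φ` is given only on a measurable set `S` of parameters, pushing `J·(dV ⊗ κ)↾S` to `dU↾O`
for a set `O` of fine fields and landing in the fibres there (`Ū(Φ z) = z.1` on `S`), then for every integrable density `ρ` SUPPORTED IN `O`
and any absolutely continuous `Ū` (`Carriers.AvgAC`, for the block averaging `T3UnitLawDensityEML.haarAC_blockAvg`):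
`(Tρ)(V) = ∫ 𝟙_S(V,r)·J(V,r)·ρ(Φ(V,r)) dκ(r)` dV-a.e. — the form print's chart (13)+(17)+(18) has (the substitution `A′ = A − D̃(A)` exists for `A` small,
the cut-off `χ` of (13)∕(49) keeps the integrand there). [cite: Balaban1985UV3, (13)–(18) pp.259–260 + (49)–(51) p.268] -/
theorem isRT_weightedFibreIntegral_local (havg : Measurable avg) (hΦ : Measurable Φ) (hJ : Measurable J)
    {S : Set (GaugeField P (j + 1) G × R)} (hS : MeasurableSet S) {O : Set (GaugeField P j G)}
    (hmap : ((((fieldMeasure P (j + 1) G).prod κ).restrict S).withDensity (fun z => (J z : ℝ≥0∞))).map Φ = (fieldMeasure P j G).restrict O)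
    (hfib : ∀ z ∈ S, avg (Φ z) = z.1) (ρ : Density P j G) (hρ : Integrable ρ (fieldMeasure P j G)) (hsupp : ∀ U, U ∉ O → ρ U = 0) :
    IsRT avg ρ (fun V => ∫ r, S.indicator (fun z => (J z : ℝ) * ρ (Φ z)) (V, r) ∂κ) := by
  intro f hf hfC
  obtain ⟨C, hC⟩ := hfC
  set ν : Measure (GaugeField P (j + 1) G × R) := ((fieldMeasure P (j + 1) G).prod κ).restrict S with hν
  set μ : Measure (GaugeField P (j + 1) G × R) := ν.withDensity (fun z => (J z : ℝ≥0∞)) with hμ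
  have hmp : MeasurePreserving Φ μ ((fieldMeasure P j G).restrict O) := ⟨hΦ, hmap⟩
  have hint : Integrable (fun U => ρ U * f (avg U)) (fieldMeasure P j G) := integrable_mul_test_comp hρ havg hf hC
  have hintO : Integrable (fun U => ρ U * f (avg U)) ((fieldMeasure P j G).restrict O) := hint.mono_measure Measure.restrict_le_self
  have hpull : Integrable ((fun U => ρ U * f (avg U)) ∘ Φ) μ := (hmp.integrable_comp hintO.aestronglyMeasurable).mpr hintO
  -- on `μ`, almost every parameter lies in `S`, where `Ū ∘ Φ = fst`
  have haeS : ∀ᵐ z ∂μ, z ∈ S := by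
    rw [hμ]
    exact (withDensity_absolutelyContinuous _ _).ae_le (ae_restrict_mem hS)
  have hpull' : Integrable (fun z : GaugeField P (j + 1) G × R => ρ (Φ z) * f z.1) μ := by
    refine hpull.congr ?_
    filter_upwards [haeS] with z hz
    show ρ (Φ z) * f (avg (Φ z)) = ρ (Φ z) * f z.1
    rw [hfib z hz]
  have hsmul : Integrable (fun z : GaugeField P (j + 1) G × R => J z • (ρ (Φ z) * f z.1)) ν :=
    (integrable_withDensity_iff_integrable_smul hJ).mp hpull'
  have hind : Integrable (fun z : GaugeField P (j + 1) G × R => S.indicator (fun z => (J z : ℝ) * ρ (Φ z)) z * f z.1)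
      ((fieldMeasure P (j + 1) G).prod κ) := by
    have h1 : Integrable (S.indicator (fun z : GaugeField P (j + 1) G × R => (J z : ℝ) * ρ (Φ z) * f z.1))
        ((fieldMeasure P (j + 1) G).prod κ) := by
      rw [integrable_indicator_iff hS]
      exact hsmul.congr (Filter.Eventually.of_forall fun z => by simp only [NNReal.smul_def, smul_eq_mul, mul_assoc])
    refine h1.congr (Filter.Eventually.of_forall fun z => ?_)
    by_cases hz : z ∈ S
    · simp only [Set.indicator_of_mem hz]
    · simp only [Set.indicator_of_notMem hz, zero_mul]
  calc ∫ V, (∫ r, S.indicator (fun z => (J z : ℝ) * ρ (Φ z)) (V, r) ∂κ) * f V ∂(fieldMeasure P (j + 1) G)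
      = ∫ V, ∫ r, S.indicator (fun z => (J z : ℝ) * ρ (Φ z)) (V, r) * f V ∂κ ∂(fieldMeasure P (j + 1) G) := by
        refine integral_congr_ae (Filter.Eventually.of_forall fun V => ?_)
        exact (integral_mul_const (f V) _).symm
    _ = ∫ z, S.indicator (fun z => (J z : ℝ) * ρ (Φ z)) z * f z.1 ∂((fieldMeasure P (j + 1) G).prod κ) := (integral_prod _ hind).symm
    _ = ∫ z, S.indicator (fun z => (J z : ℝ) * ρ (Φ z) * f z.1) z ∂((fieldMeasure P (j + 1) G).prod κ) := by
        refine integral_congr_ae (Filter.Eventually.of_forall fun z => ?_)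
        by_cases hz : z ∈ S
        · simp only [Set.indicator_of_mem hz]
        · simp only [Set.indicator_of_notMem hz, zero_mul]
    _ = ∫ z, (J z : ℝ) * ρ (Φ z) * f z.1 ∂ν := integral_indicator hS
    _ = ∫ z, J z • (ρ (Φ z) * f z.1) ∂ν := by
        refine integral_congr_ae (Filter.Eventually.of_forall fun z => ?_)
        simp only [NNReal.smul_def, smul_eq_mul, mul_assoc]
    _ = ∫ z, ρ (Φ z) * f z.1 ∂μ := (integral_withDensity_eq_integral_smul hJ _).symm
    _ = ∫ z, ((fun U => ρ U * f (avg U)) ∘ Φ) z ∂μ := by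
        refine integral_congr_ae ?_
        filter_upwards [haeS] with z hz
        show ρ (Φ z) * f z.1 = ρ (Φ z) * f (avg (Φ z))
        rw [hfib z hz]
    _ = ∫ U, ρ U * f (avg U) ∂((fieldMeasure P j G).restrict O) := by
        rw [← hmap, integral_map hΦ.aemeasurable]
        · rfl
        · rw [hmap]; exact hintO.aestronglyMeasurable
    _ = ∫ U, ρ U * f (avg U) ∂(fieldMeasure P j G) :=
        setIntegral_eq_integral_of_forall_compl_eq_zero fun U hU => by rw [hsupp U hU, zero_mul]

/-- The local weighted fibre integral of an integrable density supported in `O` is integrable. [folklore] -/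
theorem integrable_weightedFibreIntegral_local (hΦ : Measurable Φ) (hJ : Measurable J)
    {S : Set (GaugeField P (j + 1) G × R)} (hS : MeasurableSet S) {O : Set (GaugeField P j G)}
    (hmap : ((((fieldMeasure P (j + 1) G).prod κ).restrict S).withDensity (fun z => (J z : ℝ≥0∞))).map Φ = (fieldMeasure P j G).restrict O)
    (ρ : Density P j G) (hρ : Integrable ρ (fieldMeasure P j G)) :
    Integrable (fun V => ∫ r, S.indicator (fun z => (J z : ℝ) * ρ (Φ z)) (V, r) ∂κ) (fieldMeasure P (j + 1) G) := by
  have hmp : MeasurePreserving Φ ((((fieldMeasure P (j + 1) G).prod κ).restrict S).withDensity (fun z => (J z : ℝ≥0∞)))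
      ((fieldMeasure P j G).restrict O) := ⟨hΦ, hmap⟩
  have hρO : Integrable ρ ((fieldMeasure P j G).restrict O) := hρ.mono_measure Measure.restrict_le_self
  have hcomp : Integrable (ρ ∘ Φ) ((((fieldMeasure P (j + 1) G).prod κ).restrict S).withDensity (fun z => (J z : ℝ≥0∞))) :=
    (hmp.integrable_comp hρO.aestronglyMeasurable).mpr hρO
  have hsmul : Integrable (fun z => J z • (ρ ∘ Φ) z) (((fieldMeasure P (j + 1) G).prod κ).restrict S) :=
    (integrable_withDensity_iff_integrable_smul hJ).mp hcomp
  have hind : Integrable (S.indicator (fun z : GaugeField P (j + 1) G × R => (J z : ℝ) * ρ (Φ z))) ((fieldMeasure P (j + 1) G).prod κ) := by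
    rw [integrable_indicator_iff hS]
    exact hsmul.congr (Filter.Eventually.of_forall fun z => by simp only [Function.comp, NNReal.smul_def, smul_eq_mul])
  exact hind.integral_prod_left

/-- ★ **THE WEIGHTED FIBRE FORMULA, LOCAL FORM, FOR THE RADON–NIKODYM TRANSPORT**: under the hypotheses of `isRT_weightedFibreIntegral_local` and
`Carriers.AvgAC Ū`, `(Tρ)(V) = ∫ 𝟙_S(V,r)·J(V,r)·ρ(Φ(V,r)) dκ(r)` for dV-a.e. `V`. [cite: Balaban1985UV3, (13)–(18) pp.259–260 + (49)–(51) p.268] -/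
theorem rnTransport_ae_eq_weightedFibreIntegral_local (hAC : AvgAC avg) (hΦ : Measurable Φ) (hJ : Measurable J)
    {S : Set (GaugeField P (j + 1) G × R)} (hS : MeasurableSet S) {O : Set (GaugeField P j G)}
    (hmap : ((((fieldMeasure P (j + 1) G).prod κ).restrict S).withDensity (fun z => (J z : ℝ≥0∞))).map Φ = (fieldMeasure P j G).restrict O)
    (hfib : ∀ z ∈ S, avg (Φ z) = z.1) (ρ : Density P j G) (hρ : Integrable ρ (fieldMeasure P j G)) (hsupp : ∀ U, U ∉ O → ρ U = 0) :
    rnTransport avg ρ =ᵐ[fieldMeasure P (j + 1) G] fun V => ∫ r, S.indicator (fun z => (J z : ℝ) * ρ (Φ z)) (V, r) ∂κ :=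
  IsRT.ae_eq (isRT_rnTransport_of_ac hAC ρ hρ)
    (isRT_weightedFibreIntegral_local hAC.measurable hΦ hJ hS hmap hfib ρ hρ hsupp) hAC.measurable hρ (integrable_rnTransport avg ρ hρ)
    (integrable_weightedFibreIntegral_local hΦ hJ hS hmap ρ hρ)

end Summit.QuantumFields.YangMills.Theorems.WeightedFibreFormula

end
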